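import Mathlib

/-!
# From a chain to a word (`stub_chainToWord`)

A *letter* `l : Fin 3 × Fin 3 × ℂ × Option σ` encodes the elementary matrix
`Matrix.transvection l.1 l.2.1 (C l.2.2.1 * l.2.2.2.elim 1 X)` over `MvPolynomial σ ℂ`, i.e.
`E_ij(c)` (variable slot `none`, a *constant* letter) or `E_ij(c · x_v)` (variable slot `some v`,
a *variable* letter); the matrix of a word is the product of its letters.  A *chain* is a list
`L` of pairs `(v, N)`, `N` a constant square-zero `3 × 3` matrix, with matrix `Π (1 + x_v • N)`.

**Chain to word.**  Assume (abstractly) that every nonzero square-zero `N` factors as `u wᵀ`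
with `wᵀ u = 0`, and that every such pair is *completed* by a product `g` of at most `c₀`
constant elementary matrices (`g e₀ = u`, `wᵀ g = e₂ᵀ`).  Then each chain factor is the matrix
of the word `g · E_02(x_v) · g⁻¹`, of length `≤ 2 c₀ + 1` with exactly one variable letter
(`g⁻¹` is the reversed word with negated coefficients), because
`g E_02(x) g⁻¹ = 1 + x · (g e₀) (e₂ᵀ g⁻¹) = 1 + x · u wᵀ`.  Concatenating over the chain gives
a word of length `≤ (2 c₀ + 1) · |L|` with the matrix of the chain.
-/

-- `Summit.ValiantsHypothesis.ValiantsHypothesis.…` is the tree's mandated single-conjunct layout.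
set_option linter.dupNamespace false

namespace Summit.ValiantsHypothesis.ValiantsHypothesis.Theorems.WordPerSuperQuartic

open MvPolynomial

/-- Functoriality of transvections under an entrywise ring homomorphism. -/
private theorem ctw_transvection_map {m R S : Type*} [DecidableEq m] [Fintype m]
    [CommRing R] [CommRing S] (f : R →+* S) (i j : m) (c : R) :
    (Matrix.transvection i j c).map f = Matrix.transvection i j (f c) := by
  ext k l
  simp only [Matrix.transvection, Matrix.map_apply, Matrix.add_apply, Matrix.one_apply,
    Matrix.single_apply]
  split_ifs <;> simp

/-- A word of off-diagonal elementary matrices times the reversed word with negated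
coefficients is the identity. -/
private theorem ctw_prod_mul_prod_reverse_neg {m R : Type*} [DecidableEq m] [Fintype m]
    [CommRing R] (l : List (m × m × R)) (hl : ∀ t ∈ l, t.1 ≠ t.2.1) :
    (l.map (fun t => Matrix.transvection t.1 t.2.1 t.2.2)).prod *
      ((l.reverse.map (fun t => (t.1, t.2.1, -t.2.2))).map
        (fun t => Matrix.transvection t.1 t.2.1 t.2.2)).prod = 1 := by
  induction l with
  | nil => simp
  | cons t l ih =>
    have key : ∀ A B : Matrix m m R, A * B = 1 →
        Matrix.transvection t.1 t.2.1 t.2.2 * A *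
          (B * Matrix.transvection t.1 t.2.1 (-t.2.2)) = 1 := by
      intro A B h
      rw [Matrix.mul_assoc, ← Matrix.mul_assoc A, h, Matrix.one_mul,
        Matrix.transvection_mul_transvection_same _ _ (hl t List.mem_cons_self), add_neg_cancel,
        Matrix.transvection_zero]
    simpa only [List.map_cons, List.prod_cons, List.reverse_cons, List.map_append, List.map_nil,
      List.prod_append, List.prod_nil, mul_one] using
      key _ _ (ih (fun t' ht' => hl t' (List.mem_cons_of_mem _ ht')))

/-- The constant embedding of the identity matrix is the identity matrix. -/
private theorem ctw_map_one {σ : Type} :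
    (1 : Matrix (Fin 3) (Fin 3) ℂ).map (C : ℂ → MvPolynomial σ ℂ) = 1 :=
  Matrix.map_one _ (map_zero _) (map_one _)

/-- A block of constant letters multiplies to the constant embedding of the product of its
elementary matrices. -/
private theorem ctw_const_block {σ : Type} (l : List (Fin 3 × Fin 3 × ℂ)) :
    ((l.map (fun t => (t.1, t.2.1, t.2.2, (none : Option σ)))).map
        (fun l => Matrix.transvection l.1 l.2.1
          (MvPolynomial.C l.2.2.1 * l.2.2.2.elim 1 MvPolynomial.X : MvPolynomial σ ℂ))).prod =
      ((l.map (fun t => Matrix.transvection t.1 t.2.1 t.2.2)).prod).map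
        (C : ℂ → MvPolynomial σ ℂ) := by
  induction l with
  | nil =>
    rw [List.map_nil, List.map_nil, List.map_nil, List.prod_nil, List.prod_nil]
    exact ctw_map_one.symm
  | cons t l ih =>
    simp only [List.map_cons, List.prod_cons, Option.elim_none, mul_one]
    rw [Matrix.map_mul, ctw_transvection_map, ih]

/-- The variable letter `E_02(x_v)` is the chain factor `1 + x_v • E_02`. -/
private theorem ctw_mid {σ : Type} (v : σ) :
    Matrix.transvection (0 : Fin 3) 2 (C 1 * X v : MvPolynomial σ ℂ) =
      (1 : Matrix (Fin 3) (Fin 3) (MvPolynomial σ ℂ)) +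
        (X v : MvPolynomial σ ℂ) •
          (Matrix.single (0 : Fin 3) (2 : Fin 3) (1 : ℂ)).map (C : ℂ → MvPolynomial σ ℂ) := by
  rw [Matrix.transvection, Matrix.map_single, Matrix.smul_single, smul_eq_mul, mul_comm]

/-- **Conjugation identity.**  For a constant `g` with right inverse `g'`, `g e₀ = u` and
`wᵀ g = e₂ᵀ`, conjugating the chain factor `1 + x_v • E_02` by `g` gives `1 + x_v • u wᵀ`. -/
private theorem ctw_key {σ : Type} (v : σ) (g g' : Matrix (Fin 3) (Fin 3) ℂ) (hg : g * g' = 1)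
    (u w : Fin 3 → ℂ) (hu : g.mulVec (Pi.single 0 1) = u)
    (hw : Matrix.vecMul w g = Pi.single 2 1) :
    g.map (C : ℂ → MvPolynomial σ ℂ) *
        ((1 : Matrix (Fin 3) (Fin 3) (MvPolynomial σ ℂ)) +
          (X v : MvPolynomial σ ℂ) •
            (Matrix.single (0 : Fin 3) (2 : Fin 3) (1 : ℂ)).map (C : ℂ → MvPolynomial σ ℂ)) *
      g'.map (C : ℂ → MvPolynomial σ ℂ) =
    (1 : Matrix (Fin 3) (Fin 3) (MvPolynomial σ ℂ)) +
      (X v : MvPolynomial σ ℂ) • (Matrix.vecMulVec u w).map (C : ℂ → MvPolynomial σ ℂ) := by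
  have hw' : Matrix.vecMul (Pi.single (2 : Fin 3) (1 : ℂ)) g' = w := by
    rw [← hw, Matrix.vecMul_vecMul, hg, Matrix.vecMul_one]
  have hN : g * Matrix.single (0 : Fin 3) (2 : Fin 3) (1 : ℂ) * g' = Matrix.vecMulVec u w := by
    rw [Matrix.single_eq_single_vecMulVec_single, Matrix.mul_vecMulVec, Matrix.vecMulVec_mul, hu,
      hw']
  rw [Matrix.mul_add, Matrix.mul_one, Matrix.add_mul, ← Matrix.map_mul, hg, ctw_map_one,
    Matrix.mul_smul, Matrix.smul_mul, ← Matrix.map_mul, ← Matrix.map_mul, hN]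

/-- **One chain factor.**  `1 + x_v • N` (`N² = 0`, `N` constant) is the matrix of a word of
length `≤ 2 c₀ + 1` with off-diagonal letters and at most one variable letter, which reads
`x_v`. -/
private theorem ctw_piece {σ : Type} (c₀ : ℕ)
    (hfac : ∀ N : Matrix (Fin 3) (Fin 3) ℂ, N * N = 0 →
      N = 0 ∨ ∃ u w : Fin 3 → ℂ, u ≠ 0 ∧ w ≠ 0 ∧ w ⬝ᵥ u = 0 ∧ N = Matrix.vecMulVec u w)
    (hpc : ∀ u w : Fin 3 → ℂ, u ≠ 0 → w ≠ 0 → w ⬝ᵥ u = 0 →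
      ∃ l : List (Fin 3 × Fin 3 × ℂ), l.length ≤ c₀ ∧ (∀ t ∈ l, t.1 ≠ t.2.1) ∧
        (l.map (fun t => Matrix.transvection t.1 t.2.1 t.2.2)).prod.mulVec (Pi.single 0 1) = u ∧
        Matrix.vecMul w (l.map (fun t => Matrix.transvection t.1 t.2.1 t.2.2)).prod = Pi.single 2 1)
    (v : σ) (N : Matrix (Fin 3) (Fin 3) ℂ) (hN : N * N = 0) :
    ∃ p : List (Fin 3 × Fin 3 × ℂ × Option σ), p.length ≤ 2 * c₀ + 1 ∧
      (∀ l ∈ p, l.1 ≠ l.2.1) ∧ (∀ l ∈ p, ∀ v', l.2.2.2 = some v' → v' = v) ∧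
      p.countP (fun l => l.2.2.2.isSome) ≤ 1 ∧
      (p.map (fun l => Matrix.transvection l.1 l.2.1
          (MvPolynomial.C l.2.2.1 * l.2.2.2.elim 1 MvPolynomial.X : MvPolynomial σ ℂ))).prod =
        (1 : Matrix (Fin 3) (Fin 3) (MvPolynomial σ ℂ)) +
          (MvPolynomial.X v : MvPolynomial σ ℂ) •
            N.map (MvPolynomial.C : ℂ → MvPolynomial σ ℂ) := by
  rcases hfac N hN with rfl | ⟨u, w, hu, hw, hwu, rfl⟩
  · -- `N = 0`: the factor is the identity, the empty word.
    refine ⟨[], by simp, by simp, by simp, by simp, ?_⟩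
    have h0 : (0 : Matrix (Fin 3) (Fin 3) ℂ).map (C : ℂ → MvPolynomial σ ℂ) = 0 :=
      Matrix.map_zero _ (map_zero _)
    rw [List.map_nil, List.prod_nil, h0, smul_zero, add_zero]
  · -- `N = u wᵀ`: conjugate `E_02(x_v)` by the completing word `g`.
    obtain ⟨l, hl, hl', hgu, hwg⟩ := hpc u w hu hw hwu
    have h02 : (0 : Fin 3) ≠ 2 := by decide
    refine ⟨l.map (fun t => (t.1, t.2.1, t.2.2, (none : Option σ))) ++
        (((0 : Fin 3), (2 : Fin 3), (1 : ℂ), some v) ::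
          (l.reverse.map (fun t => (t.1, t.2.1, -t.2.2))).map
            (fun t => (t.1, t.2.1, t.2.2, (none : Option σ)))), ?_, ?_, ?_, ?_, ?_⟩
    · simp only [List.length_append, List.length_cons, List.length_map, List.length_reverse]
      omega
    · intro x hx
      rcases List.mem_append.1 hx with hx | hx
      · obtain ⟨t, ht, rfl⟩ := List.mem_map.1 hx
        exact hl' t ht
      · rcases List.mem_cons.1 hx with rfl | hx
        · exact h02
        · obtain ⟨t', ht', rfl⟩ := List.mem_map.1 hx
          obtain ⟨t, ht, rfl⟩ := List.mem_map.1 ht'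
          exact hl' t (List.mem_reverse.1 ht)
    · intro x hx v' hv'
      rcases List.mem_append.1 hx with hx | hx
      · obtain ⟨t, _, rfl⟩ := List.mem_map.1 hx
        simp at hv'
      · rcases List.mem_cons.1 hx with rfl | hx
        · exact (Option.some.inj hv').symm
        · obtain ⟨t', _, rfl⟩ := List.mem_map.1 hx
          simp at hv'
    · have h0 : ∀ l' : List (Fin 3 × Fin 3 × ℂ),
          (l'.map (fun t => (t.1, t.2.1, t.2.2, (none : Option σ)))).countP
            (fun l => l.2.2.2.isSome) = 0 := by
        intro l'
        rw [List.countP_eq_zero]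
        intro x hx
        obtain ⟨t, _, rfl⟩ := List.mem_map.1 hx
        simp
      rw [List.countP_append, List.countP_cons, h0, h0]
      simp
    · simp only [List.map_append, List.map_cons, List.prod_append, List.prod_cons,
        Option.elim_some]
      rw [ctw_const_block, ctw_const_block, ctw_mid, ← Matrix.mul_assoc]
      exact ctw_key v _ _ (ctw_prod_mul_prod_reverse_neg l hl') u w hgu hwg

/-- S1c — **chain to word**.  Given square-zero factorisation (`hfac`) and pair completion with
constant `c₀` (`hpc`), every chain `L` of pairs `(v, N)` (`N² = 0`) is computed by a word of
length `≤ (2 c₀ + 1) · |L|` with off-diagonal letters, whose variable letters read only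
variables of the chain, at most `|L|` of them:
`Π_letters E_ij(c · x) = Π_{(v, N) ∈ L} (1 + x_v • N)`. -/
theorem stub_chainToWord {σ : Type} [DecidableEq σ] (c₀ : ℕ)
    (hfac : ∀ N : Matrix (Fin 3) (Fin 3) ℂ, N * N = 0 →
      N = 0 ∨ ∃ u w : Fin 3 → ℂ, u ≠ 0 ∧ w ≠ 0 ∧ w ⬝ᵥ u = 0 ∧ N = Matrix.vecMulVec u w)
    (hpc : ∀ u w : Fin 3 → ℂ, u ≠ 0 → w ≠ 0 → w ⬝ᵥ u = 0 →
      ∃ l : List (Fin 3 × Fin 3 × ℂ), l.length ≤ c₀ ∧ (∀ t ∈ l, t.1 ≠ t.2.1) ∧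
        (l.map (fun t => Matrix.transvection t.1 t.2.1 t.2.2)).prod.mulVec (Pi.single 0 1) = u ∧
        Matrix.vecMul w (l.map (fun t => Matrix.transvection t.1 t.2.1 t.2.2)).prod = Pi.single 2 1)
    (L : List (σ × Matrix (Fin 3) (Fin 3) ℂ)) (hN : ∀ e ∈ L, e.2 * e.2 = 0) :
    ∃ w : List (Fin 3 × Fin 3 × ℂ × Option σ), w.length ≤ (2 * c₀ + 1) * L.length ∧
      (∀ l ∈ w, l.1 ≠ l.2.1) ∧ (∀ l ∈ w, ∀ v, l.2.2.2 = some v → v ∈ L.map Prod.fst) ∧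
      w.countP (fun l => l.2.2.2.isSome) ≤ L.length ∧
      (w.map (fun l => Matrix.transvection l.1 l.2.1
          (MvPolynomial.C l.2.2.1 * l.2.2.2.elim 1 MvPolynomial.X : MvPolynomial σ ℂ))).prod =
        (L.map (fun e => (1 : Matrix (Fin 3) (Fin 3) (MvPolynomial σ ℂ)) +
          (MvPolynomial.X e.1 : MvPolynomial σ ℂ) •
            e.2.map (MvPolynomial.C : ℂ → MvPolynomial σ ℂ))).prod := by
  induction L with
  | nil => exact ⟨[], by simp, by simp, by simp, by simp, by simp⟩
  | cons e L ih =>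
    obtain ⟨w', hlen, hoff, hvar, hcnt, hprod⟩ :=
      ih (fun e' he' => hN e' (List.mem_cons_of_mem _ he'))
    obtain ⟨p, hplen, hpoff, hpvar, hpcnt, hpprod⟩ :=
      ctw_piece c₀ hfac hpc e.1 e.2 (hN e List.mem_cons_self)
    refine ⟨p ++ w', ?_, ?_, ?_, ?_, ?_⟩
    · rw [List.length_append, List.length_cons, Nat.mul_succ]
      omega
    · intro x hx
      rcases List.mem_append.1 hx with hx | hx
      · exact hpoff x hx
      · exact hoff x hx
    · intro x hx v hv
      rcases List.mem_append.1 hx with hx | hx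
      · rw [hpvar x hx v hv, List.map_cons]
        exact List.mem_cons_self
      · exact List.mem_cons_of_mem _ (hvar x hx v hv)
    · rw [List.countP_append, List.length_cons]
      omega
    · rw [List.map_append, List.prod_append, hpprod, hprod, List.map_cons, List.prod_cons]

end Summit.ValiantsHypothesis.ValiantsHypothesis.Theorems.WordPerSuperQuartic
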